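import Summits.QuantumFields.YangMills.Theorems.UnitScaleTiltProp7CurvedLandauCoreFibreMassT3
import Summits.QuantumFields.YangMills.Theorems.UnitScaleTiltProp7FibreLevelSupLocalGauge
import HarnessLib

/-!
# Route `UnitScaleTilt`, crux K1 «MinimiserStabilityRegPr» (stmt-QuantumFields-19200), route-R [RP] curved — THE CURVED LINEAR CORE ON THE NONLINEAR (0.4)-FIBRE
# WITH NO PER-LEVEL INPUT: `((1∕4)ℓ⁻² − (18 + 537600L⁴)δ)·Σ‖Y‖² − (18 + 537600L⁴)·Z ≤ (18 + 537600L⁴)·Σ‖curl_{U₀}Y‖²_HS`, `Y = WU₀* − 1`, `W̄^{(K−n)} = Ū₀^{(K−n)}`,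
# from the (14) bound (`10¹⁴L⁹ε ≤ 1`), the competitor's sup `‖W_e − U₀,e‖ ≤ ρ_W` with `2·10¹¹·L⁹·(ℓρ_W) ≤ 1`, and the divergence budget `(δ, Z)` ONLY

Cell `ym3-torus`, D-0154 (3c) twin-width seat `ym-routeR-w3` (gen 2); sequel of ✓ `…CurvedLandauCoreFibreMassT3` (the core with `Z_Q` eliminated, per-level sups displayed) and
★routeR-w1 g2's ✓ p624016 `…FibreLevelSupLocalGauge` (the per-level sups from the plaquette bound).  THEOREMS ONLY (0 `def`, 0 `sorry`); `--supports stmt-QuantumFields-19200`,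
count-neutral.  YM₃ on T³ is a ladder rung (R3), not the Clay problem; nothing here claims the stub, the crux, d = 4 or the mass gap.

THE POINT.  ✓ `Prop7CurvedLandauCoreFibreMassT3.sum_normSq_le_curl_sq_core_of_fibre_noZQ_T3` displays the per-level two-block sups `μ_j` (`72μ_j ≤ 1`, `3μ_j + 1∕24 < δ₂`,
(B6) shape `7800L³ℓμ_j ≤ θLʲ`, `10⁹L⁴θ² ≤ 1`).  ★routeR-w1 g2's ✓ `Prop7FibreLevelSupLocalGauge.twoBlockMass_le_of_plaqBound` supplies `μ_j := (d+2)L·(2dL^d)·2(d+1)Lʲρ_W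
= 240L⁴Lʲρ_W` from the (14) bound `δ := εℓ⁻²` and the competitor sup `ρ_W` under four scalar rows (`hmδ`, `h200`, `hm`, `hNδ` at `η = 3(d−1)L^{j+1}δ`).  §1 discharges, at
d = 3 and for every `j < K − n`, those four rows together with `72μ_j ≤ 1`, `3μ_j + 1∕24 < δ₂`, the (B6) shape at `θ := 1 872 000·L⁷·(ℓρ_W)` (an IDENTITY) and `10⁹L⁴θ² ≤ 1`,
from the two k-uniform numerals `10¹⁴L⁹ε ≤ 1`, `2·10¹¹L⁹(ℓρ_W) ≤ 1` (`Lʲ·L ≤ ℓ`, `Lʲ·L^{j+1}·L ≤ ℓ²`, `L ≥ 3`); §2 is the knit.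

WHAT IS PROVED (ns `…Theorems.Prop7CurvedLandauCoreFibreSupT3`).
* §1 `mu_rows_T3` — the seven per-level scalar rows; `theta_sq_le` — `10⁹L⁴θ² ≤ 1`.
* §2 ★★★ `sum_normSq_le_curl_sq_core_of_fibre_sup_T3`, ★★★ `relPoincare_core_of_fibre_sup_T3` ((ii′) currency).
DISPLAYED (honest): the (14)-type plaquette bound of `U₀` at scale `ℓ = L^{K−n}` with `10¹⁴L⁹ε ≤ 1`; the fibre identity `W̄^{(K−n)} = Ū₀^{(K−n)}`; the recursion families
`Q, G, S, Λ` (zero content — `exists_*` of ✓ `…CurvedLandauRowA` ∕ `…LineIterVsEngineOfTower`); the divergence budget `(δ, Z)` (Landau representative: `δ = Z = 0`); the competitor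
sup `‖W_e − U₀,e‖ ≤ ρ_W` with `2·10¹¹·L⁹·(ℓρ_W) ≤ 1`.  Nothing per level, no `Z_Q`, no structure row, no `ℓ²`-mass input.

References: T. Bałaban, CMP 99 (1985) 389–434 [Balaban1985BackgroundPropagators] (Thm 3.11 p.416); CMP 102 (1985) 277–309 [Balaban1985Variational] ((14)–(15) p.280,
(141)–(143) p.299, Prop. 7 p.299); CMP 98 (1985) 17–51 [Balaban1985Averaging] (Prop. 3 (122)–(126) p.36, Prop. 4 (134)–(135) p.38); CMP 109 (1987) 249–301 [Balaban1987RG1]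
((0.3)–(0.4) pp.252–253, (1.11)–(1.12) p.262).
-/

set_option autoImplicit false

noncomputable section

open scoped BigOperators Matrix.Norms.L2Operator Matrix

namespace Summit.QuantumFields.YangMills.Theorems.Prop7CurvedLandauCoreFibreSupT3

open Literature.MathematicalPhysics.QuantumFieldTheory.Balaban1983to89
open Literature.MathematicalPhysics.QuantumFieldTheory.Balaban1983to89.T3ContinuumYM3Torus
open Finset T4Continuum T4ReflectionCone BlockAveraging AveragingRT ExpMeanLog BlockAveragingEMLLinearised BlockAveragingEMLLinearisedBackground
  BlockAveragingEMLProp2 B1RG242Torus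
open B9Eq39Adjoint (curl divB)
open B10Eq27TorusAxialLog (holT unitsField toUField)
open B9TorusCalculus (torusT)
open Summit.QuantumFields.YangMills.Theorems.Prop7CurvedLandauKnitT3 (three_le_L)
open Summit.QuantumFields.YangMills.Theorems.Prop7CovIterLambdaHLambdaBridge (one_div_le_deltaSU)
open Summit.QuantumFields.YangMills.Theorems.Prop7CurvedLandauCoreFibreMassT3 (sum_normSq_le_curl_sq_core_of_fibre_noZQ_T3 relPoincare_core_of_fibre_noZQ_T3)
open Summit.QuantumFields.YangMills.Theorems.Prop7FibreLevelSupLocalGauge (twoBlockMass_le_of_plaqBound)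

/-! ## §1 The per-level scalar rows at d = 3 -/

set_option maxHeartbeats 400000 in
/-- THE SEVEN PER-LEVEL ROWS (d = 3, `SU(2)`, level `j < K − n`, `δ := εℓ⁻²`, `ρ := ρ_W`): the four rows of ✓ `twoBlockMass_le_of_plaqBound` at `η = 3(d−1)L^{j+1}δ`,
then `72μ_j ≤ 1`, `3μ_j + 1∕24 < δ₂` and the (B6) shape `7800L³ℓμ_j ≤ θLʲ` at `θ := 1 872 000·L⁷·(ℓρ_W)` — all from `10¹⁴L⁹ε ≤ 1`, `2·10¹¹L⁹(ℓρ_W) ≤ 1`, `L ≥ 3`. [folklore] -/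
theorem mu_rows_T3 (F : T3Family) (n K : ℕ) {ε ρW : ℝ} (hε : 0 < ε) (hεL : 100000000000000 * (F.L : ℝ) ^ 9 * ε ≤ 1)
    (hρ0 : 0 ≤ ρW) (hρW : 200000000000 * (F.L : ℝ) ^ 9 * (((F.L : ℝ) ^ (K - n)) * ρW) ≤ 1) (j : ℕ) (hj : j < K - n) :
    (((((F.P K).d : ℝ) + 1) * ((18 : ℝ) ^ (F.P K).d * (2 + (((F.P K).d : ℝ) + 1) * (18 : ℝ) ^ (F.P K).d))) * (324 * ((((F.P K).d + 2) * (F.P K).L : ℕ) : ℝ) ^ 2) /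
        (((F.P K).L : ℝ) * (((F.P K).L : ℝ) - 1)) * ((((F.P K).d : ℝ) + 1) * ((F.P K).L : ℝ) ^ j * ((((F.P K).d - 1 : ℕ) : ℝ) * (3 * ((F.P K).L : ℝ) ^ (j + 1)) * (ε * ((((F.L : ℝ) ^ (K - n))) ^ 2)⁻¹))) ≤ 1) ∧
    (200 * ((((F.P K).d + 2) * (F.P K).L : ℕ) : ℝ) * (((((F.P K).d : ℝ) + 1) * ((F.P K).L : ℝ) ^ j * ρW) + ((((F.P K).d : ℝ) + 1) * ((F.P K).L : ℝ) ^ j * ((((F.P K).d - 1 : ℕ) : ℝ) * (3 * ((F.P K).L : ℝ) ^ (j + 1)) * (ε * ((((F.L : ℝ) ^ (K - n))) ^ 2)⁻¹)))) ≤ 1) ∧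
    (((((F.P K).d : ℝ) + 1) * ((18 : ℝ) ^ (F.P K).d * (2 + (((F.P K).d : ℝ) + 1) * (18 : ℝ) ^ (F.P K).d))) * (5200 * ((((F.P K).d + 2) * (F.P K).L : ℕ) : ℝ) ^ 2) /
        (((F.P K).L : ℝ) * (((F.P K).L : ℝ) - 1)) * (((((F.P K).d : ℝ) + 1) * ((F.P K).L : ℝ) ^ j * ρW) + ((((F.P K).d : ℝ) + 1) * ((F.P K).L : ℝ) ^ j * ((((F.P K).d - 1 : ℕ) : ℝ) * (3 * ((F.P K).L : ℝ) ^ (j + 1)) * (ε * ((((F.L : ℝ) ^ (K - n))) ^ 2)⁻¹)))) ≤ 1) ∧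
    (4 * ((((F.P K).d + 2) * (F.P K).L : ℕ) : ℝ) * (((((F.P K).d : ℝ) + 1) * ((F.P K).L : ℝ) ^ j * ρW) + ((((F.P K).d : ℝ) + 1) * ((F.P K).L : ℝ) ^ j * ((((F.P K).d - 1 : ℕ) : ℝ) * (3 * ((F.P K).L : ℝ) ^ (j + 1)) * (ε * ((((F.L : ℝ) ^ (K - n))) ^ 2)⁻¹)))) < deltaSU (Fin 2)) ∧
    72 * (((((F.P K).d + 2) * (F.P K).L : ℕ) : ℝ) * ((2 * (F.P K).d * ((F.P K).L : ℝ) ^ (F.P K).d) * (2 * ((((F.P K).d : ℝ) + 1) * ((F.P K).L : ℝ) ^ j * ρW)))) ≤ 1 ∧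
    3 * (((((F.P K).d + 2) * (F.P K).L : ℕ) : ℝ) * ((2 * (F.P K).d * ((F.P K).L : ℝ) ^ (F.P K).d) * (2 * ((((F.P K).d : ℝ) + 1) * ((F.P K).L : ℝ) ^ j * ρW)))) + 1 / 24 < deltaSU (Fin 2) ∧
    7800 * (F.L : ℝ) ^ 3 * ((F.L : ℝ) ^ (K - n)) * (((((F.P K).d + 2) * (F.P K).L : ℕ) : ℝ) * ((2 * (F.P K).d * ((F.P K).L : ℝ) ^ (F.P K).d) * (2 * ((((F.P K).d : ℝ) + 1) * ((F.P K).L : ℝ) ^ j * ρW)))) ≤ (1872000 * (F.L : ℝ) ^ 7 * (((F.L : ℝ) ^ (K - n)) * ρW)) * (F.L : ℝ) ^ j := by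
  have hL3 := three_le_L F
  have hL0 : (0 : ℝ) < (F.L : ℝ) := by linarith
  have hL1 : (1 : ℝ) ≤ (F.L : ℝ) := by linarith
  have hd : (F.P K).d = 3 := rfl
  have hLF' : (F.P K).L = F.L := rfl
  have hδS := one_div_le_deltaSU 2
  -- geometry of the scales: `Lʲ·L ≤ ℓ`, `L·Lʲ·L^{j+1} ≤ ℓ²`
  have hjk : j + 1 ≤ K - n := hj
  have hLj : (F.L : ℝ) * (F.L : ℝ) ^ j ≤ (F.L : ℝ) ^ (K - n) := by
    rw [← pow_succ']; exact pow_le_pow_right₀ hL1 hjk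
  have hLjj : (F.L : ℝ) * ((F.L : ℝ) ^ j * (F.L : ℝ) ^ (j + 1)) ≤ ((F.L : ℝ) ^ (K - n)) ^ 2 := by
    rw [← pow_add, ← pow_succ', ← pow_mul]; exact pow_le_pow_right₀ hL1 (by omega)
  have hℓ0 : 0 < (F.L : ℝ) ^ (K - n) := by positivity
  have hℓ2 : 0 < ((F.L : ℝ) ^ (K - n)) ^ 2 := by positivity
  -- the two small quantities `u := ℓρ_W`, `ε`, and the products that carry them
  have ha' : (F.L : ℝ) * ((F.L : ℝ) ^ j * ρW) ≤ (F.L : ℝ) ^ (K - n) * ρW := by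
    rw [← mul_assoc]; exact mul_le_mul_of_nonneg_right hLj hρ0
  have hq' : (F.L : ℝ) * ((F.L : ℝ) ^ j * ((F.L : ℝ) ^ (j + 1) * (ε * (((F.L : ℝ) ^ (K - n)) ^ 2)⁻¹))) ≤ ε := by
    have e : (F.L : ℝ) * ((F.L : ℝ) ^ j * ((F.L : ℝ) ^ (j + 1) * (ε * (((F.L : ℝ) ^ (K - n)) ^ 2)⁻¹)))
        = ((F.L : ℝ) * ((F.L : ℝ) ^ j * (F.L : ℝ) ^ (j + 1))) * (((F.L : ℝ) ^ (K - n)) ^ 2)⁻¹ * ε := by ring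
    rw [e]
    have h1 : ((F.L : ℝ) * ((F.L : ℝ) ^ j * (F.L : ℝ) ^ (j + 1))) * (((F.L : ℝ) ^ (K - n)) ^ 2)⁻¹ ≤ 1 := by
      rw [mul_inv_le_iff₀ hℓ2, one_mul]; exact hLjj
    have := mul_le_mul_of_nonneg_right h1 hε.le
    linarith
  have hL9 : (19683 : ℝ) ≤ (F.L : ℝ) ^ 9 := by
    have := pow_le_pow_left₀ (by norm_num : (0 : ℝ) ≤ 3) hL3 9
    norm_num at this
    exact this
  have hu0 : 0 ≤ (F.L : ℝ) ^ (K - n) * ρW := by positivity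
  have hu : 200000000000 * 19683 * ((F.L : ℝ) ^ (K - n) * ρW) ≤ 1 :=
    le_trans (by nlinarith [mul_le_mul_of_nonneg_right hL9 hu0]) hρW
  have hεs : 100000000000000 * 19683 * ε ≤ 1 :=
    le_trans (by nlinarith [mul_le_mul_of_nonneg_right hL9 hε.le]) hεL
  have hDpos : (0 : ℝ) < (F.L : ℝ) * ((F.L : ℝ) - 1) := mul_pos hL0 (by linarith)
  have hL2 : 0 ≤ ((F.L : ℝ) - 3) * (F.L : ℝ) := mul_nonneg (by linarith) hL0.le
  simp only [hd, hLF']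
  push_cast
  refine ⟨?_, ?_, ?_, ?_, ?_, ?_, ?_⟩
  · -- hmδ
    rw [div_mul_eq_mul_div, div_le_one hDpos]
    have P2 := mul_le_mul_of_nonneg_left hq' (by positivity : (0 : ℝ) ≤ 105800691456000 * (F.L : ℝ))
    have P3 := mul_le_mul_of_nonneg_left hεs hL0.le
    nlinarith [P2, P3, hL2, hL0]
  · -- h200
    have P1 := mul_le_mul_of_nonneg_left ha' (by norm_num : (0 : ℝ) ≤ 4000)
    have P2 := mul_le_mul_of_nonneg_left hq' (by norm_num : (0 : ℝ) ≤ 24000)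
    nlinarith [P1, P2, hu, hεs]
  · -- hm
    rw [div_mul_eq_mul_div, div_le_one hDpos]
    have P1 := mul_le_mul_of_nonneg_left ha' (by positivity : (0 : ℝ) ≤ 4 * 70751491200000 * (F.L : ℝ))
    have P2 := mul_le_mul_of_nonneg_left hq' (by positivity : (0 : ℝ) ≤ 24 * 70751491200000 * (F.L : ℝ))
    have P3 := mul_le_mul_of_nonneg_left hu hL0.le
    have P4 := mul_le_mul_of_nonneg_left hεs hL0.le
    nlinarith [P1, P2, P3, P4, hL2, hL0]
  · -- hNδ
    have P1 := mul_le_mul_of_nonneg_left ha' (by norm_num : (0 : ℝ) ≤ 80)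
    have P2 := mul_le_mul_of_nonneg_left hq' (by norm_num : (0 : ℝ) ≤ 480)
    push_cast at hδS
    nlinarith [P1, P2, hu, hεs, hδS]
  · -- 72 μ_j ≤ 1
    have hL3u : (F.L : ℝ) ^ 3 * ((F.L : ℝ) ^ (K - n) * ρW) ≤ (F.L : ℝ) ^ 9 * ((F.L : ℝ) ^ (K - n) * ρW) :=
      mul_le_mul_of_nonneg_right (pow_le_pow_right₀ hL1 (by norm_num)) hu0
    have P1 := mul_le_mul_of_nonneg_left ha' (by positivity : (0 : ℝ) ≤ 17280 * (F.L : ℝ) ^ 3)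
    nlinarith [P1, hL3u, hρW]
  · -- 3 μ_j + 1/24 < δ₂
    have hL3u : (F.L : ℝ) ^ 3 * ((F.L : ℝ) ^ (K - n) * ρW) ≤ (F.L : ℝ) ^ 9 * ((F.L : ℝ) ^ (K - n) * ρW) :=
      mul_le_mul_of_nonneg_right (pow_le_pow_right₀ hL1 (by norm_num)) hu0
    have P1 := mul_le_mul_of_nonneg_left ha' (by positivity : (0 : ℝ) ≤ 720 * (F.L : ℝ) ^ 3)
    push_cast at hδS
    nlinarith [P1, hL3u, hρW, hδS]
  · -- the (B6) shape is an identity at `θ := 1 872 000·L⁷·(ℓρ_W)`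
    exact le_of_eq (by ring)

/-- `10⁹·L⁴·θ² ≤ 1` at `θ := 1 872 000·L⁷·(ℓρ_W)` from `2·10¹¹·L⁹·(ℓρ_W) ≤ 1`. [folklore] -/
theorem theta_sq_le (F : T3Family) (n K : ℕ) {ρW : ℝ} (hρ0 : 0 ≤ ρW) (hρW : 200000000000 * (F.L : ℝ) ^ 9 * (((F.L : ℝ) ^ (K - n)) * ρW) ≤ 1) :
    1000000000 * (F.L : ℝ) ^ 4 * (1872000 * (F.L : ℝ) ^ 7 * (((F.L : ℝ) ^ (K - n)) * ρW)) ^ 2 ≤ 1 := by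
  have hL3 := three_le_L F
  have hu0 : 0 ≤ (F.L : ℝ) ^ (K - n) * ρW := by positivity
  have hv0 : 0 ≤ 200000000000 * (F.L : ℝ) ^ 9 * ((F.L : ℝ) ^ (K - n) * ρW) := by positivity
  have hsq : (200000000000 * (F.L : ℝ) ^ 9 * ((F.L : ℝ) ^ (K - n) * ρW)) ^ 2 ≤ 1 := by nlinarith
  have e : 1000000000 * (F.L : ℝ) ^ 4 * (1872000 * (F.L : ℝ) ^ 7 * (((F.L : ℝ) ^ (K - n)) * ρW)) ^ 2
      = (876096 / 10000000) * (200000000000 * (F.L : ℝ) ^ 9 * ((F.L : ℝ) ^ (K - n) * ρW)) ^ 2 := by ring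
  rw [e]
  nlinarith [hsq]

/-! ## §2 ★★★ The fibre core from the plaquette bound, the competitor sup and the divergence budget only -/

set_option maxHeartbeats 400000 in
/-- ★★★ **THE CURVED LINEAR CORE ON THE NONLINEAR (0.4)-FIBRE — NO PER-LEVEL INPUT (d = 3, `SU(2)`).**  `U₀, W` on the finest torus of run `K`, `W̄^{(K−n)} = Ū₀^{(K−n)}`;
`dist1(U₀(∂p)) ≤ εℓ⁻²` (`ℓ = L^{K−n}`, `0 < ε`, `10¹⁴L⁹ε ≤ 1`); `‖W_e − U₀,e‖ ≤ ρ_W` on every finest bond with `2·10¹¹·L⁹·(ℓρ_W) ≤ 1`; `Y := pertVar U₀ W`; `Q, G, S, Λ` the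
recursion families of record at `Y` (displayed, zero content); the divergence budget `Σ‖D^*_{U₀}Y‖²_HS ≤ δΣ‖Y‖² + Z`.  THEN
`((1∕4)ℓ⁻² − (18 + 537600L⁴)δ)·Σ‖Y‖² − (18 + 537600L⁴)·Z ≤ (18 + 537600L⁴)·Σ‖curl_{U₀}Y‖²_HS` — k- and volume-uniform.
[cite: Balaban1985BackgroundPropagators, Thm 3.11 p.416; Balaban1985Variational, (14)-(15) p.280, Prop. 7 p.299; Balaban1985Averaging, Prop. 3 (122)-(126) p.36, Prop. 4 (134)-(135) p.38] -/
theorem sum_normSq_le_curl_sq_core_of_fibre_sup_T3 (F : T3Family) (n K : ℕ)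
    (U₀ W : GaugeField (F.P K) 0 (Matrix.specialUnitaryGroup (Fin 2) ℂ)) {ε : ℝ} (hε : 0 < ε) (hεL : 100000000000000 * (F.L : ℝ) ^ 9 * ε ≤ 1)
    (hU : ∀ p : Plaq (F.P K) 0, dist1 (GaugeField.plaqHol U₀ p) ≤ ε * (((F.L : ℝ) ^ (K - n)) ^ 2)⁻¹)
    (hfib : Averaging.iter (fun i => blockAvg (P := (F.P K)) (j := i) (expMeanLogSU (n := Fin 2))) (K - n) W = Averaging.iter (fun i => blockAvg (P := (F.P K)) (j := i) (expMeanLogSU (n := Fin 2))) (K - n) U₀)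
    (Q : (k : ℕ) → (PBond (F.P K) 0 → Matrix (Fin 2) (Fin 2) ℂ) → PBond (F.P K) k → Matrix (Fin 2) (Fin 2) ℂ) (hQ0 : ∀ Y, Q 0 Y = Y)
    (hQs : ∀ (k : ℕ) (Y : PBond (F.P K) 0 → Matrix (Fin 2) (Fin 2) ℂ) (c : PBond (F.P K) (k + 1)), Q (k + 1) Y c
      = (fderiv ℂ (eml : (Idx (F.P K) → Matrix (Fin 2) (Fin 2) ℂ) → Matrix (Fin 2) (Fin 2) ℂ)
            (fun i => ((loopHol (Averaging.iter (fun i => blockAvg (P := (F.P K)) (j := i) (expMeanLogSU (n := Fin 2))) k U₀) c i : Matrix.specialUnitaryGroup (Fin 2) ℂ) : Matrix (Fin 2) (Fin 2) ℂ))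
            (fun i => covWalkSum (Averaging.iter (fun i => blockAvg (P := (F.P K)) (j := i) (expMeanLogSU (n := Fin 2))) k U₀) (Q k Y) (walk (emb c.src) (loopWord (F.P K).L c.dir (off i.1) i.2.1 i.2.2))
              * ((loopHol (Averaging.iter (fun i => blockAvg (P := (F.P K)) (j := i) (expMeanLogSU (n := Fin 2))) k U₀) c i : Matrix.specialUnitaryGroup (Fin 2) ℂ) : Matrix (Fin 2) (Fin 2) ℂ))
            * star ((corr (expMeanLogSU (n := Fin 2)) (Averaging.iter (fun i => blockAvg (P := (F.P K)) (j := i) (expMeanLogSU (n := Fin 2))) k U₀) c : Matrix.specialUnitaryGroup (Fin 2) ℂ) : Matrix (Fin 2) (Fin 2) ℂ)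
          + ((corr (expMeanLogSU (n := Fin 2)) (Averaging.iter (fun i => blockAvg (P := (F.P K)) (j := i) (expMeanLogSU (n := Fin 2))) k U₀) c : Matrix.specialUnitaryGroup (Fin 2) ℂ) : Matrix (Fin 2) (Fin 2) ℂ)
            * covWalkSum (Averaging.iter (fun i => blockAvg (P := (F.P K)) (j := i) (expMeanLogSU (n := Fin 2))) k U₀) (Q k Y) (walk (emb c.src) (List.replicate (F.P K).L (c.dir, true)))
            * star ((corr (expMeanLogSU (n := Fin 2)) (Averaging.iter (fun i => blockAvg (P := (F.P K)) (j := i) (expMeanLogSU (n := Fin 2))) k U₀) c : Matrix.specialUnitaryGroup (Fin 2) ℂ) : Matrix (Fin 2) (Fin 2) ℂ)))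
    (G S : (k : ℕ) → PBond (F.P K) k → Matrix (Fin 2) (Fin 2) ℂ) (Λ : (k : ℕ) → Site (F.P K) k → Matrix (Fin 2) (Fin 2) ℂ)
    (hG0 : ∀ b, G 0 b = pertVar U₀ W b) (hS0 : ∀ b, S 0 b = pertVar U₀ W b) (hΛ0 : ∀ x, Λ 0 x = 0)
    (hΛs : ∀ (k : ℕ) (z : Site (F.P K) (k + 1)), Λ (k + 1) z
      = (((Fintype.card (Idx (F.P K)) : ℂ))⁻¹ • ∑ i : Idx (F.P K),
              covWalkSum (Averaging.iter (fun i => blockAvg (P := (F.P K)) (j := i) (expMeanLogSU (n := Fin 2))) k U₀) (G k) (walk (emb z) (stairWord i.2.1 (off i.1))))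
        + Λ k (emb z))
    (hGs : ∀ (k : ℕ) (c : PBond (F.P K) (k + 1)), G (k + 1) c
      = (fderiv ℂ (eml : (Idx (F.P K) → Matrix (Fin 2) (Fin 2) ℂ) → Matrix (Fin 2) (Fin 2) ℂ)
            (fun i => ((loopHol (Averaging.iter (fun i => blockAvg (P := (F.P K)) (j := i) (expMeanLogSU (n := Fin 2))) k U₀) c i : Matrix.specialUnitaryGroup (Fin 2) ℂ) : Matrix (Fin 2) (Fin 2) ℂ))
            (fun i => covWalkSum (Averaging.iter (fun i => blockAvg (P := (F.P K)) (j := i) (expMeanLogSU (n := Fin 2))) k U₀) (G k) (walk (emb c.src) (loopWord (F.P K).L c.dir (off i.1) i.2.1 i.2.2))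
              * ((loopHol (Averaging.iter (fun i => blockAvg (P := (F.P K)) (j := i) (expMeanLogSU (n := Fin 2))) k U₀) c i : Matrix.specialUnitaryGroup (Fin 2) ℂ) : Matrix (Fin 2) (Fin 2) ℂ))
            * star ((corr (expMeanLogSU (n := Fin 2)) (Averaging.iter (fun i => blockAvg (P := (F.P K)) (j := i) (expMeanLogSU (n := Fin 2))) k U₀) c : Matrix.specialUnitaryGroup (Fin 2) ℂ) : Matrix (Fin 2) (Fin 2) ℂ)
          + ((corr (expMeanLogSU (n := Fin 2)) (Averaging.iter (fun i => blockAvg (P := (F.P K)) (j := i) (expMeanLogSU (n := Fin 2))) k U₀) c : Matrix.specialUnitaryGroup (Fin 2) ℂ) : Matrix (Fin 2) (Fin 2) ℂ)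
            * covWalkSum (Averaging.iter (fun i => blockAvg (P := (F.P K)) (j := i) (expMeanLogSU (n := Fin 2))) k U₀) (G k) (walk (emb c.src) (List.replicate (F.P K).L (c.dir, true)))
            * star ((corr (expMeanLogSU (n := Fin 2)) (Averaging.iter (fun i => blockAvg (P := (F.P K)) (j := i) (expMeanLogSU (n := Fin 2))) k U₀) c : Matrix.specialUnitaryGroup (Fin 2) ℂ) : Matrix (Fin 2) (Fin 2) ℂ))
        - ((((Fintype.card (Idx (F.P K)) : ℂ))⁻¹ • ∑ i : Idx (F.P K),
              covWalkSum (Averaging.iter (fun i => blockAvg (P := (F.P K)) (j := i) (expMeanLogSU (n := Fin 2))) k U₀) (G k) (walk (emb c.src) (stairWord i.2.1 (off i.1))))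
            - ((Averaging.iter (fun i => blockAvg (P := (F.P K)) (j := i) (expMeanLogSU (n := Fin 2))) (k + 1) U₀ c : Matrix.specialUnitaryGroup (Fin 2) ℂ) : Matrix (Fin 2) (Fin 2) ℂ)
              * (((Fintype.card (Idx (F.P K)) : ℂ))⁻¹ • ∑ i : Idx (F.P K),
              covWalkSum (Averaging.iter (fun i => blockAvg (P := (F.P K)) (j := i) (expMeanLogSU (n := Fin 2))) k U₀) (G k) (walk (emb c.tgt) (stairWord i.2.1 (off i.1))))
              * star ((Averaging.iter (fun i => blockAvg (P := (F.P K)) (j := i) (expMeanLogSU (n := Fin 2))) (k + 1) U₀ c : Matrix.specialUnitaryGroup (Fin 2) ℂ) : Matrix (Fin 2) (Fin 2) ℂ)))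
    (hSs : ∀ (k : ℕ) (c : PBond (F.P K) (k + 1)), S (k + 1) c
      = ((Fintype.card (Idx (F.P K)) : ℂ))⁻¹ • ∑ i : Idx (F.P K),
          ((holAt (Averaging.iter (fun i => blockAvg (P := (F.P K)) (j := i) (expMeanLogSU (n := Fin 2))) k U₀) (walk (emb c.src) (stairWord i.2.1 (off i.1))) : Matrix.specialUnitaryGroup (Fin 2) ℂ) : Matrix (Fin 2) (Fin 2) ℂ) *
            covWalkSum (Averaging.iter (fun i => blockAvg (P := (F.P K)) (j := i) (expMeanLogSU (n := Fin 2))) k U₀) (S k)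
              (walk (walkEnd (emb c.src) (stairWord i.2.1 (off i.1))) (List.replicate (F.P K).L (c.dir, true))) *
          star ((holAt (Averaging.iter (fun i => blockAvg (P := (F.P K)) (j := i) (expMeanLogSU (n := Fin 2))) k U₀) (walk (emb c.src) (stairWord i.2.1 (off i.1))) : Matrix.specialUnitaryGroup (Fin 2) ℂ) : Matrix (Fin 2) (Fin 2) ℂ))
    {δ Z : ℝ}
    (hdivB : (∑ x : Site (F.P K) 0, ∑ j : Fin 2, ∑ k : Fin 2,
            ‖(divB (torusT (F.P K) 0) (fun κ z => unitsField (toUField U₀) ⟨z, κ⟩) (fun κ z => pertVar U₀ W ⟨z, κ⟩) x) j k‖ ^ 2)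
      ≤ δ * (∑ b : PBond (F.P K) 0, ‖pertVar U₀ W b‖ ^ 2) + Z)
    {ρW : ℝ} (hρ0 : 0 ≤ ρW) (hρW : 200000000000 * (F.L : ℝ) ^ 9 * (((F.L : ℝ) ^ (K - n)) * ρW) ≤ 1)
    (hW : ∀ e : PBond (F.P K) 0, ‖((W e : Matrix.specialUnitaryGroup (Fin 2) ℂ) : Matrix (Fin 2) (Fin 2) ℂ) - ((U₀ e : Matrix.specialUnitaryGroup (Fin 2) ℂ) : Matrix (Fin 2) (Fin 2) ℂ)‖ ≤ ρW) :
    ((1 / 4) * ((((F.L : ℝ) ^ (K - n))) ^ 2)⁻¹ - (18 + 537600 * (F.L : ℝ) ^ 4) * δ) * (∑ b : PBond (F.P K) 0, ‖pertVar U₀ W b‖ ^ 2) - (18 + 537600 * (F.L : ℝ) ^ 4) * Z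
      ≤ (18 + 537600 * (F.L : ℝ) ^ 4) * (∑ x : Site (F.P K) 0, ∑ μ : Fin (F.P K).d, ∑ ν : Fin (F.P K).d,
            (if μ < ν then ∑ j : Fin 2, ∑ k : Fin 2,
              ‖(curl (torusT (F.P K) 0) (fun κ z => unitsField (toUField U₀) ⟨z, κ⟩) (fun κ z => pertVar U₀ W ⟨z, κ⟩) μ ν x) j k‖ ^ 2 else 0)) := by
  have hm1 : 1 ≤ F.m := F.hm
  have hk1 : ∀ j < K - n, j + 1 < (F.P K).m + (F.P K).K := fun j hj => by show j + 1 < F.m + K; omega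
  have hδ0 : 0 ≤ ε * (((F.L : ℝ) ^ (K - n)) ^ 2)⁻¹ := by positivity
  have hrows := mu_rows_T3 F n K hε hεL hρ0 hρW
  have hμ : ∀ j < K - n, ∀ c : PBond (F.P K) (j + 1),
      ((((F.P K).d + 2) * (F.P K).L : ℕ) : ℝ) * ∑ b ∈ (univ.filter (fun b : PBond (F.P K) j => blockOf b.src = c.src ∨ blockOf b.src = c.tgt)), ‖(pertVar (Averaging.iter (fun i => blockAvg (P := (F.P K)) (j := i) (expMeanLogSU (n := Fin 2))) j U₀) (Averaging.iter (fun i => blockAvg (P := (F.P K)) (j := i) (expMeanLogSU (n := Fin 2))) j W)) b‖ ≤ (((((F.P K).d + 2) * (F.P K).L : ℕ) : ℝ) * ((2 * (F.P K).d * ((F.P K).L : ℝ) ^ (F.P K).d) * (2 * ((((F.P K).d : ℝ) + 1) * ((F.P K).L : ℝ) ^ j * ρW)))) := by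
    intro j hj c
    obtain ⟨h1, h2, h3, h4, -, -, -⟩ := hrows j hj
    exact twoBlockMass_le_of_plaqBound (hk1 j hj) c W U₀ hρ0 hδ0 hU hW h1 h2 h3 h4
  exact sum_normSq_le_curl_sq_core_of_fibre_noZQ_T3 F n K U₀ W hε hεL hU hfib Q hQ0 hQs G S Λ hG0 hS0 hΛ0 hΛs hGs hSs hdivB
    (fun j => (((((F.P K).d + 2) * (F.P K).L : ℕ) : ℝ) * ((2 * (F.P K).d * ((F.P K).L : ℝ) ^ (F.P K).d) * (2 * ((((F.P K).d : ℝ) + 1) * ((F.P K).L : ℝ) ^ j * ρW))))) (fun j _ => by positivity) hμ (fun j hj => (hrows j hj).2.2.2.2.1) (fun j hj => (hrows j hj).2.2.2.2.2.1)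
    (θ := (1872000 * (F.L : ℝ) ^ 7 * (((F.L : ℝ) ^ (K - n)) * ρW))) (by positivity) (fun j hj => (hrows j hj).2.2.2.2.2.2) (theta_sq_le F n K hρ0 hρW)

set_option maxHeartbeats 400000 in
/-- ★★★ **THE SAME IN THE (ii′) CURRENCY** (relative plaquettes on the right; `‖WU₀* − 1‖ ≤ s ≤ 1` bondwise).
[cite: Balaban1985Variational, (141)-(143) p.299; Balaban1985BackgroundPropagators, Thm 3.11 p.416] -/
theorem relPoincare_core_of_fibre_sup_T3 (F : T3Family) (n K : ℕ)
    (U₀ W : GaugeField (F.P K) 0 (Matrix.specialUnitaryGroup (Fin 2) ℂ)) {ε : ℝ} (hε : 0 < ε) (hεL : 100000000000000 * (F.L : ℝ) ^ 9 * ε ≤ 1)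
    (hU : ∀ p : Plaq (F.P K) 0, dist1 (GaugeField.plaqHol U₀ p) ≤ ε * (((F.L : ℝ) ^ (K - n)) ^ 2)⁻¹)
    (hfib : Averaging.iter (fun i => blockAvg (P := (F.P K)) (j := i) (expMeanLogSU (n := Fin 2))) (K - n) W = Averaging.iter (fun i => blockAvg (P := (F.P K)) (j := i) (expMeanLogSU (n := Fin 2))) (K - n) U₀)
    (Q : (k : ℕ) → (PBond (F.P K) 0 → Matrix (Fin 2) (Fin 2) ℂ) → PBond (F.P K) k → Matrix (Fin 2) (Fin 2) ℂ) (hQ0 : ∀ Y, Q 0 Y = Y)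
    (hQs : ∀ (k : ℕ) (Y : PBond (F.P K) 0 → Matrix (Fin 2) (Fin 2) ℂ) (c : PBond (F.P K) (k + 1)), Q (k + 1) Y c
      = (fderiv ℂ (eml : (Idx (F.P K) → Matrix (Fin 2) (Fin 2) ℂ) → Matrix (Fin 2) (Fin 2) ℂ)
            (fun i => ((loopHol (Averaging.iter (fun i => blockAvg (P := (F.P K)) (j := i) (expMeanLogSU (n := Fin 2))) k U₀) c i : Matrix.specialUnitaryGroup (Fin 2) ℂ) : Matrix (Fin 2) (Fin 2) ℂ))
            (fun i => covWalkSum (Averaging.iter (fun i => blockAvg (P := (F.P K)) (j := i) (expMeanLogSU (n := Fin 2))) k U₀) (Q k Y) (walk (emb c.src) (loopWord (F.P K).L c.dir (off i.1) i.2.1 i.2.2))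
              * ((loopHol (Averaging.iter (fun i => blockAvg (P := (F.P K)) (j := i) (expMeanLogSU (n := Fin 2))) k U₀) c i : Matrix.specialUnitaryGroup (Fin 2) ℂ) : Matrix (Fin 2) (Fin 2) ℂ))
            * star ((corr (expMeanLogSU (n := Fin 2)) (Averaging.iter (fun i => blockAvg (P := (F.P K)) (j := i) (expMeanLogSU (n := Fin 2))) k U₀) c : Matrix.specialUnitaryGroup (Fin 2) ℂ) : Matrix (Fin 2) (Fin 2) ℂ)
          + ((corr (expMeanLogSU (n := Fin 2)) (Averaging.iter (fun i => blockAvg (P := (F.P K)) (j := i) (expMeanLogSU (n := Fin 2))) k U₀) c : Matrix.specialUnitaryGroup (Fin 2) ℂ) : Matrix (Fin 2) (Fin 2) ℂ)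
            * covWalkSum (Averaging.iter (fun i => blockAvg (P := (F.P K)) (j := i) (expMeanLogSU (n := Fin 2))) k U₀) (Q k Y) (walk (emb c.src) (List.replicate (F.P K).L (c.dir, true)))
            * star ((corr (expMeanLogSU (n := Fin 2)) (Averaging.iter (fun i => blockAvg (P := (F.P K)) (j := i) (expMeanLogSU (n := Fin 2))) k U₀) c : Matrix.specialUnitaryGroup (Fin 2) ℂ) : Matrix (Fin 2) (Fin 2) ℂ)))
    (G S : (k : ℕ) → PBond (F.P K) k → Matrix (Fin 2) (Fin 2) ℂ) (Λ : (k : ℕ) → Site (F.P K) k → Matrix (Fin 2) (Fin 2) ℂ)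
    (hG0 : ∀ b, G 0 b = pertVar U₀ W b) (hS0 : ∀ b, S 0 b = pertVar U₀ W b) (hΛ0 : ∀ x, Λ 0 x = 0)
    (hΛs : ∀ (k : ℕ) (z : Site (F.P K) (k + 1)), Λ (k + 1) z
      = (((Fintype.card (Idx (F.P K)) : ℂ))⁻¹ • ∑ i : Idx (F.P K),
              covWalkSum (Averaging.iter (fun i => blockAvg (P := (F.P K)) (j := i) (expMeanLogSU (n := Fin 2))) k U₀) (G k) (walk (emb z) (stairWord i.2.1 (off i.1))))
        + Λ k (emb z))
    (hGs : ∀ (k : ℕ) (c : PBond (F.P K) (k + 1)), G (k + 1) c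
      = (fderiv ℂ (eml : (Idx (F.P K) → Matrix (Fin 2) (Fin 2) ℂ) → Matrix (Fin 2) (Fin 2) ℂ)
            (fun i => ((loopHol (Averaging.iter (fun i => blockAvg (P := (F.P K)) (j := i) (expMeanLogSU (n := Fin 2))) k U₀) c i : Matrix.specialUnitaryGroup (Fin 2) ℂ) : Matrix (Fin 2) (Fin 2) ℂ))
            (fun i => covWalkSum (Averaging.iter (fun i => blockAvg (P := (F.P K)) (j := i) (expMeanLogSU (n := Fin 2))) k U₀) (G k) (walk (emb c.src) (loopWord (F.P K).L c.dir (off i.1) i.2.1 i.2.2))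
              * ((loopHol (Averaging.iter (fun i => blockAvg (P := (F.P K)) (j := i) (expMeanLogSU (n := Fin 2))) k U₀) c i : Matrix.specialUnitaryGroup (Fin 2) ℂ) : Matrix (Fin 2) (Fin 2) ℂ))
            * star ((corr (expMeanLogSU (n := Fin 2)) (Averaging.iter (fun i => blockAvg (P := (F.P K)) (j := i) (expMeanLogSU (n := Fin 2))) k U₀) c : Matrix.specialUnitaryGroup (Fin 2) ℂ) : Matrix (Fin 2) (Fin 2) ℂ)
          + ((corr (expMeanLogSU (n := Fin 2)) (Averaging.iter (fun i => blockAvg (P := (F.P K)) (j := i) (expMeanLogSU (n := Fin 2))) k U₀) c : Matrix.specialUnitaryGroup (Fin 2) ℂ) : Matrix (Fin 2) (Fin 2) ℂ)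
            * covWalkSum (Averaging.iter (fun i => blockAvg (P := (F.P K)) (j := i) (expMeanLogSU (n := Fin 2))) k U₀) (G k) (walk (emb c.src) (List.replicate (F.P K).L (c.dir, true)))
            * star ((corr (expMeanLogSU (n := Fin 2)) (Averaging.iter (fun i => blockAvg (P := (F.P K)) (j := i) (expMeanLogSU (n := Fin 2))) k U₀) c : Matrix.specialUnitaryGroup (Fin 2) ℂ) : Matrix (Fin 2) (Fin 2) ℂ))
        - ((((Fintype.card (Idx (F.P K)) : ℂ))⁻¹ • ∑ i : Idx (F.P K),
              covWalkSum (Averaging.iter (fun i => blockAvg (P := (F.P K)) (j := i) (expMeanLogSU (n := Fin 2))) k U₀) (G k) (walk (emb c.src) (stairWord i.2.1 (off i.1))))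
            - ((Averaging.iter (fun i => blockAvg (P := (F.P K)) (j := i) (expMeanLogSU (n := Fin 2))) (k + 1) U₀ c : Matrix.specialUnitaryGroup (Fin 2) ℂ) : Matrix (Fin 2) (Fin 2) ℂ)
              * (((Fintype.card (Idx (F.P K)) : ℂ))⁻¹ • ∑ i : Idx (F.P K),
              covWalkSum (Averaging.iter (fun i => blockAvg (P := (F.P K)) (j := i) (expMeanLogSU (n := Fin 2))) k U₀) (G k) (walk (emb c.tgt) (stairWord i.2.1 (off i.1))))
              * star ((Averaging.iter (fun i => blockAvg (P := (F.P K)) (j := i) (expMeanLogSU (n := Fin 2))) (k + 1) U₀ c : Matrix.specialUnitaryGroup (Fin 2) ℂ) : Matrix (Fin 2) (Fin 2) ℂ)))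
    (hSs : ∀ (k : ℕ) (c : PBond (F.P K) (k + 1)), S (k + 1) c
      = ((Fintype.card (Idx (F.P K)) : ℂ))⁻¹ • ∑ i : Idx (F.P K),
          ((holAt (Averaging.iter (fun i => blockAvg (P := (F.P K)) (j := i) (expMeanLogSU (n := Fin 2))) k U₀) (walk (emb c.src) (stairWord i.2.1 (off i.1))) : Matrix.specialUnitaryGroup (Fin 2) ℂ) : Matrix (Fin 2) (Fin 2) ℂ) *
            covWalkSum (Averaging.iter (fun i => blockAvg (P := (F.P K)) (j := i) (expMeanLogSU (n := Fin 2))) k U₀) (S k)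
              (walk (walkEnd (emb c.src) (stairWord i.2.1 (off i.1))) (List.replicate (F.P K).L (c.dir, true))) *
          star ((holAt (Averaging.iter (fun i => blockAvg (P := (F.P K)) (j := i) (expMeanLogSU (n := Fin 2))) k U₀) (walk (emb c.src) (stairWord i.2.1 (off i.1))) : Matrix.specialUnitaryGroup (Fin 2) ℂ) : Matrix (Fin 2) (Fin 2) ℂ))
    {δ Z : ℝ}
    (hdivB : (∑ x : Site (F.P K) 0, ∑ j : Fin 2, ∑ k : Fin 2,
            ‖(divB (torusT (F.P K) 0) (fun κ z => unitsField (toUField U₀) ⟨z, κ⟩) (fun κ z => pertVar U₀ W ⟨z, κ⟩) x) j k‖ ^ 2)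
      ≤ δ * (∑ b : PBond (F.P K) 0, ‖pertVar U₀ W b‖ ^ 2) + Z)
    {ρW : ℝ} (hρ0 : 0 ≤ ρW) (hρW : 200000000000 * (F.L : ℝ) ^ 9 * (((F.L : ℝ) ^ (K - n)) * ρW) ≤ 1)
    (hW : ∀ e : PBond (F.P K) 0, ‖((W e : Matrix.specialUnitaryGroup (Fin 2) ℂ) : Matrix (Fin 2) (Fin 2) ℂ) - ((U₀ e : Matrix.specialUnitaryGroup (Fin 2) ℂ) : Matrix (Fin 2) (Fin 2) ℂ)‖ ≤ ρW)
    {s : ℝ} (hδW : ∀ b : PBond (F.P K) 0, ‖pertVar U₀ W b‖ ≤ s) (hs1 : s ≤ 1) :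
    ((1 / 4) * ((((F.L : ℝ) ^ (K - n))) ^ 2)⁻¹ - (18 + 537600 * (F.L : ℝ) ^ 4) * δ
        - (18 + 537600 * (F.L : ℝ) ^ 4) * (24576 * s ^ 2 + 768 * (ε * ((((F.L : ℝ) ^ (K - n))) ^ 2)⁻¹) ^ 2)) * (∑ b : PBond (F.P K) 0, ‖pertVar U₀ W b‖ ^ 2) - (18 + 537600 * (F.L : ℝ) ^ 4) * Z
      ≤ (18 + 537600 * (F.L : ℝ) ^ 4) * (4 * ∑ p : Plaq (F.P K) 0,
        ‖((GaugeField.plaqHol W p : Matrix.specialUnitaryGroup (Fin 2) ℂ) : Matrix (Fin 2) (Fin 2) ℂ)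
          * star ((GaugeField.plaqHol U₀ p : Matrix.specialUnitaryGroup (Fin 2) ℂ) : Matrix (Fin 2) (Fin 2) ℂ) - 1‖ ^ 2) := by
  have hm1 : 1 ≤ F.m := F.hm
  have hk1 : ∀ j < K - n, j + 1 < (F.P K).m + (F.P K).K := fun j hj => by show j + 1 < F.m + K; omega
  have hδ0 : 0 ≤ ε * (((F.L : ℝ) ^ (K - n)) ^ 2)⁻¹ := by positivity
  have hrows := mu_rows_T3 F n K hε hεL hρ0 hρW
  have hμ : ∀ j < K - n, ∀ c : PBond (F.P K) (j + 1),
      ((((F.P K).d + 2) * (F.P K).L : ℕ) : ℝ) * ∑ b ∈ (univ.filter (fun b : PBond (F.P K) j => blockOf b.src = c.src ∨ blockOf b.src = c.tgt)), ‖(pertVar (Averaging.iter (fun i => blockAvg (P := (F.P K)) (j := i) (expMeanLogSU (n := Fin 2))) j U₀) (Averaging.iter (fun i => blockAvg (P := (F.P K)) (j := i) (expMeanLogSU (n := Fin 2))) j W)) b‖ ≤ (((((F.P K).d + 2) * (F.P K).L : ℕ) : ℝ) * ((2 * (F.P K).d * ((F.P K).L : ℝ) ^ (F.P K).d) * (2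 * ((((F.P K).d : ℝ) + 1) * ((F.P K).L : ℝ) ^ j * ρW)))) := by
    intro j hj c
    obtain ⟨h1, h2, h3, h4, -, -, -⟩ := hrows j hj
    exact twoBlockMass_le_of_plaqBound (hk1 j hj) c W U₀ hρ0 hδ0 hU hW h1 h2 h3 h4
  exact relPoincare_core_of_fibre_noZQ_T3 F n K U₀ W hε hεL hU hfib Q hQ0 hQs G S Λ hG0 hS0 hΛ0 hΛs hGs hSs hdivB
    (fun j => (((((F.P K).d + 2) * (F.P K).L : ℕ) : ℝ) * ((2 * (F.P K).d * ((F.P K).L : ℝ) ^ (F.P K).d) * (2 * ((((F.P K).d : ℝ) + 1) * ((F.P K).L : ℝ) ^ j * ρW))))) (fun j _ => by positivity) hμ (fun j hj => (hrows j hj).2.2.2.2.1) (fun j hj => (hrows j hj).2.2.2.2.2.1)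
    (θ := (1872000 * (F.L : ℝ) ^ 7 * (((F.L : ℝ) ^ (K - n)) * ρW))) (by positivity) (fun j hj => (hrows j hj).2.2.2.2.2.2) (theta_sq_le F n K hρ0 hρW) hδW hs1

end Summit.QuantumFields.YangMills.Theorems.Prop7CurvedLandauCoreFibreSupT3

end
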